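import Mathlib.Analysis.CStarAlgebra.Matrix
import Mathlib.Analysis.Calculus.FDeriv.Mul
import Mathlib.Analysis.Calculus.ContDiff.Operations
import Mathlib.LinearAlgebra.Matrix.Symmetric
import HarnessLib

/-!
# Fields of endomorphisms of Euclidean space given by matrices of functions: smoothness,
# derivatives, components, symmetry (topic `Analysis/Calculus`)

Elementary calculus of operator fields `x ↦ M(x) ∈ End(ℝⁿ)` on a normed space, where
`M(x) = Matrix.toEuclideanCLM (m(x))` is given by a matrix of real functions `m(x)ᵢⱼ`
(`Matrix.toEuclideanCLM`, the star-algebra isomorphism `Matrix n n ℝ ≃⋆ₐ End(EuclideanSpace ℝ n)`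
of Mathlib). Writing `M(x) = Σᵢⱼ m(x)ᵢⱼ • Eᵢⱼ` over the matrix units
(`toEuclideanCLM_eq_sum_smul`) reduces everything to scalar calculus, so that no norm on the
matrix type is needed:

* `contDiff_toEuclideanCLM` — the field is `C^n` when the entries are;
* `hasFDerivAt_toEuclideanCLM`, `fderiv_toEuclideanCLM_apply` — its derivative along `v` is the
  operator of the matrix of the derivatives of the entries along `v`;
* `toEuclideanCLM_apply_coord` — components: `(M w)ᵢ = Σⱼ mᵢⱼ wⱼ`;
* `inner_toEuclideanCLM_comm` — for a symmetric matrix the operator is symmetric for the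
  Euclidean inner product.

These are the bookkeeping lemmas with which first-order systems `∂ₜW = Σₖ 𝔄ᵏ ∂ₖW + 𝔅 W` with
explicit matrix coefficients are put in the operator format of Friedrichs' theory of symmetric
hyperbolic systems (Friedrichs 1954, §1). Everything is proved; no named fact and no `sorry` is
introduced.

## References

* K. O. Friedrichs, *Symmetric hyperbolic linear differential equations*, Comm. Pure Appl. Math.
  7 (1954) 345–392, §1 (systems with symmetric coefficient matrices). [Friedrichs1954]
-/

noncomputable section

open scoped RealInnerProductSpace

namespace Literature.Analysis.Calculus

namespace MatrixField

variable {n : Type*} [Fintype n] [DecidableEq n]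
variable {X : Type*} [NormedAddCommGroup X] [NormedSpace ℝ X]

/-- The endomorphism of `EuclideanSpace ℝ n` with matrix `A` in the standard basis (Mathlib's
`Matrix.toEuclideanCLM` over `ℝ`). -/
local notation "toOp" => Matrix.toEuclideanCLM (𝕜 := ℝ)

/-! ### The operator of a matrix as a combination of matrix units -/

omit [Fintype n] in
/-- `single i j a = a • single i j 1`. [folklore] -/
theorem single_eq_smul_single_one (i j : n) (a : ℝ) :
    Matrix.single i j a = a • Matrix.single i j (1 : ℝ) := by
  rw [Matrix.smul_single, smul_eq_mul, mul_one]

/-- **`op A = Σᵢⱼ Aᵢⱼ • Eᵢⱼ`**, `Eᵢⱼ = op (single i j 1)` the matrix units (linearity of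
`toEuclideanCLM` over the expansion of a matrix in matrix units). [folklore] -/
theorem toEuclideanCLM_eq_sum_smul (A : Matrix n n ℝ) :
    toOp A = ∑ i, ∑ j, A i j • toOp (Matrix.single i j (1 : ℝ)) := by
  have h : A = ∑ i, ∑ j, A i j • Matrix.single i j (1 : ℝ) := by
    conv_lhs => rw [Matrix.matrix_eq_sum_single A]
    exact Finset.sum_congr rfl fun i _ ↦ Finset.sum_congr rfl fun j _ ↦
      single_eq_smul_single_one i j (A i j)
  calc toOp A = toOp (∑ i, ∑ j, A i j • Matrix.single i j (1 : ℝ)) := by rw [← h]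
    _ = ∑ i, toOp (∑ j, A i j • Matrix.single i j (1 : ℝ)) := map_sum _ _ _
    _ = ∑ i, ∑ j, A i j • toOp (Matrix.single i j (1 : ℝ)) := by
        refine Finset.sum_congr rfl fun i _ ↦ ?_
        rw [map_sum]
        exact Finset.sum_congr rfl fun j _ ↦ map_smul _ _ _

/-! ### Smoothness and derivatives of operator fields with smooth entries -/

/-- **An operator field with `C^k` matrix entries is `C^k`.** [folklore] -/
theorem contDiff_toEuclideanCLM {k : WithTop ℕ∞} {m : X → Matrix n n ℝ}
    (hm : ∀ i j, ContDiff ℝ k fun x ↦ m x i j) : ContDiff ℝ k fun x ↦ toOp (m x) := by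
  have h : (fun x ↦ toOp (m x)) = fun x ↦ ∑ i, ∑ j, m x i j • toOp (Matrix.single i j (1 : ℝ)) :=
    funext fun x ↦ toEuclideanCLM_eq_sum_smul (m x)
  rw [h]
  exact ContDiff.sum fun i _ ↦ ContDiff.sum fun j _ ↦ (hm i j).smul contDiff_const

/-- `ContDiffAt` version of `contDiff_toEuclideanCLM`. [folklore] -/
theorem contDiffAt_toEuclideanCLM {k : WithTop ℕ∞} {m : X → Matrix n n ℝ} {x : X}
    (hm : ∀ i j, ContDiffAt ℝ k (fun x ↦ m x i j) x) :
    ContDiffAt ℝ k (fun x ↦ toOp (m x)) x := by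
  have h : (fun x ↦ toOp (m x)) = fun x ↦ ∑ i, ∑ j, m x i j • toOp (Matrix.single i j (1 : ℝ)) :=
    funext fun x ↦ toEuclideanCLM_eq_sum_smul (m x)
  rw [h]
  exact ContDiffAt.sum fun i _ ↦ ContDiffAt.sum fun j _ ↦ (hm i j).smul contDiffAt_const

/-- **The derivative of an operator field is the operator of the derivatives of the entries**:
if `x ↦ m(x)ᵢⱼ` has derivative `m'ᵢⱼ` at `x` for all `i, j`, then `x ↦ op (m x)` has derivative
`v ↦ Σᵢⱼ (m'ᵢⱼ v) • Eᵢⱼ` at `x`. [folklore] -/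
theorem hasFDerivAt_toEuclideanCLM {m : X → Matrix n n ℝ} {m' : n → n → X →L[ℝ] ℝ} {x : X}
    (hm : ∀ i j, HasFDerivAt (fun x ↦ m x i j) (m' i j) x) :
    HasFDerivAt (fun x ↦ toOp (m x))
      (∑ i, ∑ j, (m' i j).smulRight (toOp (Matrix.single i j (1 : ℝ)))) x := by
  have h : (fun x ↦ toOp (m x)) = fun x ↦ ∑ i, ∑ j, m x i j • toOp (Matrix.single i j (1 : ℝ)) :=
    funext fun x ↦ toEuclideanCLM_eq_sum_smul (m x)
  rw [h]
  exact HasFDerivAt.fun_sum fun i _ ↦ HasFDerivAt.fun_sum fun j _ ↦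
    (hm i j).smul_const (toOp (Matrix.single i j (1 : ℝ)))

/-- **`∂ᵥ op(m) = op(∂ᵥ m)`**: for differentiable entries, the derivative of the operator field
along `v` is the operator of the matrix of the derivatives of the entries along `v`. [folklore] -/
theorem fderiv_toEuclideanCLM_apply {m : X → Matrix n n ℝ} {x : X}
    (hm : ∀ i j, DifferentiableAt ℝ (fun x ↦ m x i j) x) (v : X) :
    fderiv ℝ (fun x ↦ toOp (m x)) x v =
      toOp (Matrix.of fun i j ↦ fderiv ℝ (fun x ↦ m x i j) x v) := by
  rw [(hasFDerivAt_toEuclideanCLM fun i j ↦ (hm i j).hasFDerivAt).fderiv,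
    toEuclideanCLM_eq_sum_smul]
  simp only [FunLike.coe_sum, Finset.sum_apply, ContinuousLinearMap.smulRight_apply,
    Matrix.of_apply]

/-- Differentiability of an operator field with differentiable entries. [folklore] -/
theorem differentiableAt_toEuclideanCLM {m : X → Matrix n n ℝ} {x : X}
    (hm : ∀ i j, DifferentiableAt ℝ (fun x ↦ m x i j) x) :
    DifferentiableAt ℝ (fun x ↦ toOp (m x)) x :=
  (hasFDerivAt_toEuclideanCLM fun i j ↦ (hm i j).hasFDerivAt).differentiableAt

/-! ### Components, products, identity -/

/-- **Components of the operator of a matrix**: `(op A w)ᵢ = Σⱼ Aᵢⱼ wⱼ`. [folklore] -/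
theorem toEuclideanCLM_apply_coord (A : Matrix n n ℝ) (w : EuclideanSpace ℝ n) (i : n) :
    toOp A w i = ∑ j, A i j * w j := by
  have h : WithLp.ofLp (toOp A w) i = (A.mulVec (WithLp.ofLp w)) i := by
    rw [Matrix.ofLp_toEuclideanCLM]
  exact h

/-- The product of operators is the operator of the product (`toEuclideanCLM` is an algebra
homomorphism), applied form. [folklore] -/
theorem toEuclideanCLM_mul_apply (A C : Matrix n n ℝ) (w : EuclideanSpace ℝ n) :
    toOp (A * C) w = toOp A (toOp C w) := by
  have h : toOp (A * C) = toOp A * toOp C := map_mul _ A C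
  rw [h, mul_apply_eq_comp]

/-- `op 1 = id`, applied form. [folklore] -/
theorem toEuclideanCLM_one_apply (w : EuclideanSpace ℝ n) : toOp (1 : Matrix n n ℝ) w = w := by
  have h : toOp (1 : Matrix n n ℝ) = 1 := map_one _
  rw [h, one_apply_eq_self]

/-! ### Symmetry -/

/-- **The operator of a symmetric real matrix is symmetric** for the Euclidean inner product:
`⟪op A u, w⟫ = ⟪u, op A w⟫`. [folklore] -/
theorem inner_toEuclideanCLM_comm {A : Matrix n n ℝ} (hA : A.IsSymm) (u w : EuclideanSpace ℝ n) :
    ⟪toOp A u, w⟫ = ⟪u, toOp A w⟫ := by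
  rw [real_inner_comm, Matrix.inner_toEuclideanCLM, Matrix.inner_toEuclideanCLM,
    Matrix.dotProduct_mulVec, ← Matrix.mulVec_transpose, hA.eq, dotProduct_comm]

end MatrixField

end Literature.Analysis.Calculus

end
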